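import Mathlib
import HarnessLib

/-!
# Route `LoopPeriodRatchet`, support `NoPlanarExtremum` (stmt-NavierStokesRegularity-22880) — helper I:
# a Sard substitute for the plane stream function (regular levels exist below every value)

Support file (`--supports` the item; it does not close it). The item says: for an e₃-poloidal Type-I
Oseen-mild ancient profile without closed vortex lines, the plane stream function `ψ = v₃ − ∂₃Φ` of a slice
(`curl v(s) = (∂₁ψ, −∂₀ψ, 0)`) has no strict local extremum inside any horizontal plane. The proof planned in
the prover's notes rings a strict planar extremum by a REGULAR closed level curve of `ψ` (then a periodic
orbit of `y′ = curl v(s)(y)` by the tree's `Literature.Analysis.ODE.LevelCurveData`), and the one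
non-elementary input is a Sard-type statement for the in-plane critical values of `ψ` — Mathlib has Sard only
in equal dimensions. This file proves the substitute that the smoothness of the vorticity field affords:

* `abs_sub_le_of_hasDerivAt_three` — a one-variable lemma: if `g′(0) = g′(1) = 0` and `|g‴| ≤ B` on `[0,1]`
  then `|g(1) − g(0)| ≤ B` (Rolle for `g′`, then three mean-value steps);
* `exists_cubic_increment` — for `X : ℝ³ → ℝ³` of class `C²` and `ψ` differentiable with in-plane gradient
  `(∂₀ψ, ∂₁ψ) = (−X₁, X₀)`, on a compact convex set `K` there is `C` with
  `|ψ z′ − ψ z| ≤ C ‖z′ − z‖³` for all IN-PLANE CRITICAL points `z, z′ ∈ K` of one horizontal plane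
  (`X₀ = X₁ = 0` at both): along the segment, `g(t) = ψ(z + t(z′−z))` has `g′ = ⟨X^⊥, z′−z⟩`, which
  vanishes at both ends and has `|g‴| ≤ 2 sup_K ‖D²X‖ ‖z′−z‖³`;
* `exists_regular_level` — consequently the in-plane critical values of `ψ` on a closed ball are
  Lebesgue-null (`ψ` is Hölder with exponent `3` on the planar critical set `Z`, so
  `μH[1](ψ '' Z) ≤ C μH[3](Z) = 0` because a plane has Hausdorff dimension `2 < 3`; Mathlib
  `HolderOnWith.hausdorffMeasure_image_le`, `hausdorffMeasure_of_dimH_lt`, `hausdorffMeasure_real`), hence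
  every interval `(a, b)`, `a < b`, contains a level `c` at which `ψ` has no in-plane critical point in the
  ball: a regular level.

Not a claim about Navier–Stokes: elementary real analysis for the D-0145 line `LoopPeriodRatchet` (door rung
N0-LocalTubeDoorPoloidal; no summit, no Clay option). Source of the idea: A. P. Morse (1939) / A. Sard (1942);
the cubic-increment shortcut replaces the implicit-function step of the planar Morse–Sard theorem and needs
one more derivative, which the smooth vorticity slice has.
-/

noncomputable section

-- the summit and its single sub-problem share the name (CONVENTIONS §1), as in every Theorems file
set_option linter.dupNamespace false

namespace Summit.NavierStokesRegularity.NavierStokesRegularity.Theorems.LoopPeriodRatchetNoPlanarExtremumSard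

open MeasureTheory Measure Set Function Filter Topology Metric
open scoped NNReal ENNReal

/-! ### One variable: `g′(0) = g′(1) = 0`, `|g‴| ≤ B` ⇒ `|g(1) − g(0)| ≤ B` -/

/-- If `g : ℝ → ℝ` has derivatives `g₁, g₂, g₃` of orders `1, 2, 3` everywhere, `g₁ 0 = g₁ 1 = 0` and
`|g₃| ≤ B` on `[0, 1]`, then `|g 1 − g 0| ≤ B`: by Rolle `g₂` vanishes at some `ξ ∈ (0,1)`, so `|g₂| ≤ B`
on `[0,1]` (mean value), so `|g₁| ≤ B` there (`g₁ 0 = 0`), so `|g 1 − g 0| ≤ B`. -/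
theorem abs_sub_le_of_hasDerivAt_three {g g₁ g₂ g₃ : ℝ → ℝ} (hg : ∀ t, HasDerivAt g (g₁ t) t)
    (hg₁ : ∀ t, HasDerivAt g₁ (g₂ t) t) (hg₂ : ∀ t, HasDerivAt g₂ (g₃ t) t) (h0 : g₁ 0 = 0)
    (h1 : g₁ 1 = 0) {B : ℝ} (hB : ∀ t ∈ Icc (0 : ℝ) 1, |g₃ t| ≤ B) : |g 1 - g 0| ≤ B := by
  have hI : Convex ℝ (Icc (0 : ℝ) 1) := convex_Icc 0 1
  -- Rolle for `g₁` on `[0, 1]`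
  obtain ⟨ξ, hξ, hξ0⟩ := exists_hasDerivAt_eq_zero (f := g₁) (f' := g₂) zero_lt_one
    (fun t _ => (hg₁ t).continuousAt.continuousWithinAt) (by rw [h0, h1]) (fun t _ => hg₁ t)
  -- `|g₂| ≤ B` on `[0, 1]`
  have h2 : ∀ t ∈ Icc (0 : ℝ) 1, |g₂ t| ≤ B := by
    intro t ht
    have h := hI.norm_image_sub_le_of_norm_hasDerivWithin_le (f := g₂) (f' := g₃)
      (fun s _ => (hg₂ s).hasDerivWithinAt) (fun s hs => by rw [Real.norm_eq_abs]; exact hB s hs)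
      (Ioo_subset_Icc_self hξ) ht
    rw [hξ0, sub_zero, Real.norm_eq_abs, Real.norm_eq_abs] at h
    have hB0 : 0 ≤ B := (abs_nonneg _).trans (hB 0 (left_mem_Icc.2 zero_le_one))
    have hd : |t - ξ| ≤ 1 := by
      rw [abs_le]; constructor <;> linarith [ht.1, ht.2, hξ.1, hξ.2]
    nlinarith
  -- `|g₁| ≤ B` on `[0, 1]`
  have h1' : ∀ t ∈ Icc (0 : ℝ) 1, |g₁ t| ≤ B := by
    intro t ht
    have h := hI.norm_image_sub_le_of_norm_hasDerivWithin_le (f := g₁) (f' := g₂)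
      (fun s _ => (hg₁ s).hasDerivWithinAt) (fun s hs => by rw [Real.norm_eq_abs]; exact h2 s hs)
      (left_mem_Icc.2 zero_le_one) ht
    rw [h0, sub_zero, Real.norm_eq_abs, Real.norm_eq_abs, sub_zero, abs_of_nonneg ht.1] at h
    have hB0 : 0 ≤ B := (abs_nonneg _).trans (hB 0 (left_mem_Icc.2 zero_le_one))
    nlinarith [ht.2]
  -- `|g 1 − g 0| ≤ B`
  have h := hI.norm_image_sub_le_of_norm_hasDerivWithin_le (f := g) (f' := g₁)
    (fun s _ => (hg s).hasDerivWithinAt) (fun s hs => by rw [Real.norm_eq_abs]; exact h1' s hs)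
    (left_mem_Icc.2 zero_le_one) (right_mem_Icc.2 zero_le_one)
  rw [Real.norm_eq_abs, Real.norm_eq_abs, sub_zero, abs_one, mul_one] at h
  exact h

/-! ### The cubic increment of `ψ` between in-plane critical points -/

/-- Expansion of a linear functional on `ℝ³` along the standard basis:
`L h = h 0 · L e₀ + h 1 · L e₁ + h 2 · L e₂`. -/
theorem clm_apply_eq_sum_three (L : (EuclideanSpace ℝ (Fin 3)) →L[ℝ] ℝ) (h : (EuclideanSpace ℝ (Fin 3))) :
    L h = h 0 * L (EuclideanSpace.single 0 1) + h 1 * L (EuclideanSpace.single 1 1) +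
      h 2 * L (EuclideanSpace.single 2 1) := by
  have hh : h = h 0 • EuclideanSpace.single 0 1 + h 1 • EuclideanSpace.single 1 1 +
      h 2 • EuclideanSpace.single 2 1 := by
    ext i
    fin_cases i <;> simp
  conv_lhs => rw [hh]
  simp only [map_add, map_smul, smul_eq_mul]

/-- **Cubic increment of the stream function between in-plane critical points.** Let `X : ℝ³ → ℝ³` be `C²`
and `ψ : ℝ³ → ℝ` differentiable with `∂₀ψ = −X₁`, `∂₁ψ = X₀` everywhere. On a compact convex `K` there is
`C ≥ 0` such that for all `z, z′ ∈ K` in one horizontal plane (`z′ 2 = z 2`) with `X₀ = X₁ = 0` at `z` and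
at `z′`: `|ψ z′ − ψ z| ≤ C ‖z′ − z‖³`. -/
theorem exists_cubic_increment {X : (EuclideanSpace ℝ (Fin 3)) → (EuclideanSpace ℝ (Fin 3))} (hX : ContDiff ℝ 2 X) {ψ : (EuclideanSpace ℝ (Fin 3)) → ℝ}
    (hψ : Differentiable ℝ ψ)
    (hψ0 : ∀ y, fderiv ℝ ψ y (EuclideanSpace.single 0 1) = -(X y 1))
    (hψ1 : ∀ y, fderiv ℝ ψ y (EuclideanSpace.single 1 1) = X y 0)
    {K : Set (EuclideanSpace ℝ (Fin 3))} (hK : IsCompact K) (hKc : Convex ℝ K) :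
    ∃ C : ℝ, 0 ≤ C ∧ ∀ z ∈ K, ∀ z' ∈ K, z' 2 = z 2 → X z 0 = 0 → X z 1 = 0 → X z' 0 = 0 →
      X z' 1 = 0 → |ψ z' - ψ z| ≤ C * ‖z' - z‖ ^ 3 := by
  -- a uniform bound `M` for `D²X` on `K`
  have hX1 : ContDiff ℝ 1 (fderiv ℝ X) := hX.fderiv_right (m := 1) (by norm_num)
  have hDX : Differentiable ℝ X := hX.differentiable (by norm_num)
  have hDDX : Differentiable ℝ (fderiv ℝ X) := hX1.differentiable one_ne_zero
  obtain ⟨M, hM⟩ := hK.exists_bound_of_continuousOn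
    ((hX1.continuous_fderiv one_ne_zero).continuousOn)
  have hM0 : ∀ y ∈ K, ‖fderiv ℝ (fderiv ℝ X) y‖ ≤ max M 0 := fun y hy => (hM y hy).trans (le_max_left _ _)
  refine ⟨2 * max M 0, by positivity, ?_⟩
  intro z hz z' hz' hplane hX0 hX1z hX0' hX1'
  set h : (EuclideanSpace ℝ (Fin 3)) := z' - z with hh
  have hh2 : h 2 = 0 := by simp [hh, hplane]
  -- the segment stays in `K`
  have hseg : ∀ t ∈ Icc (0 : ℝ) 1, z + t • h ∈ K := by
    intro t ht
    have := hKc.add_smul_sub_mem hz hz' ht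
    simpa [hh] using this
  -- the line `L t = z + t • h` and its derivative
  have hL : ∀ t : ℝ, HasDerivAt (fun s : ℝ => z + s • h) h t := fun t => by
    simpa using ((hasDerivAt_id t).smul_const h).const_add z
  -- `g = ψ ∘ L`, `g₁ = ⟨X^⊥ ∘ L, h⟩`, `g₂`, `g₃`
  set g : ℝ → ℝ := fun t => ψ (z + t • h) with hg
  set φ : ℝ → (EuclideanSpace ℝ (Fin 3)) := fun t => X (z + t • h) with hφ
  set φ₁ : ℝ → (EuclideanSpace ℝ (Fin 3)) := fun t => fderiv ℝ X (z + t • h) h with hφ₁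
  set φ₂ : ℝ → (EuclideanSpace ℝ (Fin 3)) := fun t => (fderiv ℝ (fderiv ℝ X) (z + t • h) h) h with hφ₂
  set g₁ : ℝ → ℝ := fun t => -(h 0) * φ t 1 + h 1 * φ t 0 with hg₁
  set g₂ : ℝ → ℝ := fun t => -(h 0) * φ₁ t 1 + h 1 * φ₁ t 0 with hg₂
  set g₃ : ℝ → ℝ := fun t => -(h 0) * φ₂ t 1 + h 1 * φ₂ t 0 with hg₃
  -- derivatives
  have hgd : ∀ t, HasDerivAt g (g₁ t) t := by
    intro t
    have h1 : HasDerivAt g (fderiv ℝ ψ (z + t • h) h) t :=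
      ((hψ (z + t • h)).hasFDerivAt).comp_hasDerivAt t (hL t)
    have h2 : fderiv ℝ ψ (z + t • h) h = g₁ t := by
      rw [clm_apply_eq_sum_three, hψ0, hψ1, hh2, zero_mul, add_zero, hg₁]
      ring
    rwa [h2] at h1
  have hφd : ∀ t, HasDerivAt φ (φ₁ t) t := fun t =>
    ((hDX (z + t • h)).hasFDerivAt).comp_hasDerivAt t (hL t)
  have hφ₁d : ∀ t, HasDerivAt φ₁ (φ₂ t) t := by
    intro t
    have hA : HasFDerivAt (fun y => fderiv ℝ X y h)
        ((ContinuousLinearMap.apply ℝ (EuclideanSpace ℝ (Fin 3)) h).comp (fderiv ℝ (fderiv ℝ X) (z + t • h))) (z + t • h) :=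
      (ContinuousLinearMap.apply ℝ (EuclideanSpace ℝ (Fin 3)) h).hasFDerivAt.comp (z + t • h) (hDDX (z + t • h)).hasFDerivAt
    exact hA.comp_hasDerivAt t (hL t)
  have hcoord : ∀ (u u' : ℝ → (EuclideanSpace ℝ (Fin 3))), (∀ t, HasDerivAt u (u' t) t) → ∀ (i : Fin 3) (t : ℝ),
      HasDerivAt (fun s => u s i) (u' t i) t := by
    intro u u' hu i t
    exact (EuclideanSpace.proj (𝕜 := ℝ) i).hasFDerivAt.comp_hasDerivAt t (hu t)
  have hg₁d : ∀ t, HasDerivAt g₁ (g₂ t) t := fun t =>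
    ((hcoord φ φ₁ hφd 1 t).const_mul (-(h 0))).add ((hcoord φ φ₁ hφd 0 t).const_mul (h 1))
  have hg₂d : ∀ t, HasDerivAt g₂ (g₃ t) t := fun t =>
    ((hcoord φ₁ φ₂ hφ₁d 1 t).const_mul (-(h 0))).add ((hcoord φ₁ φ₂ hφ₁d 0 t).const_mul (h 1))
  -- `g₁` vanishes at both ends (both points are in-plane critical)
  have hg₁0 : g₁ 0 = 0 := by simp [hg₁, hφ, hX0, hX1z]
  have hg₁1 : g₁ 1 = 0 := by
    simp only [hg₁, hφ, one_smul, hh, add_sub_cancel, hX0', hX1', mul_zero, neg_mul, neg_zero, add_zero]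
  -- the bound on `g₃`
  have hB : ∀ t ∈ Icc (0 : ℝ) 1, |g₃ t| ≤ 2 * max M 0 * ‖h‖ ^ 3 := by
    intro t ht
    have hφ₂n : ‖φ₂ t‖ ≤ max M 0 * ‖h‖ * ‖h‖ := by
      calc ‖φ₂ t‖ ≤ ‖fderiv ℝ (fderiv ℝ X) (z + t • h) h‖ * ‖h‖ := ContinuousLinearMap.le_opNorm _ _
        _ ≤ ‖fderiv ℝ (fderiv ℝ X) (z + t • h)‖ * ‖h‖ * ‖h‖ := by
          gcongr; exact ContinuousLinearMap.le_opNorm _ _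
        _ ≤ max M 0 * ‖h‖ * ‖h‖ := by gcongr; exact hM0 _ (hseg t ht)
    have habs : ∀ (w : EuclideanSpace ℝ (Fin 3)) (i : Fin 3), |w i| ≤ ‖w‖ := fun w i => by
      rw [← Real.norm_eq_abs]; exact PiLp.norm_apply_le w i
    have h0n : |h 0| ≤ ‖h‖ := habs h 0
    have h1n : |h 1| ≤ ‖h‖ := habs h 1
    have hc1 : |φ₂ t 1| ≤ ‖φ₂ t‖ := habs _ 1
    have hc0 : |φ₂ t 0| ≤ ‖φ₂ t‖ := habs _ 0
    calc |g₃ t| = |-(h 0) * φ₂ t 1 + h 1 * φ₂ t 0| := rfl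
      _ ≤ |-(h 0) * φ₂ t 1| + |h 1 * φ₂ t 0| := abs_add_le _ _
      _ = |h 0| * |φ₂ t 1| + |h 1| * |φ₂ t 0| := by rw [abs_mul, abs_mul, abs_neg]
      _ ≤ ‖h‖ * ‖φ₂ t‖ + ‖h‖ * ‖φ₂ t‖ := by gcongr
      _ ≤ ‖h‖ * (max M 0 * ‖h‖ * ‖h‖) + ‖h‖ * (max M 0 * ‖h‖ * ‖h‖) := by gcongr
      _ = 2 * max M 0 * ‖h‖ ^ 3 := by ring
  have hmain := abs_sub_le_of_hasDerivAt_three hgd hg₁d hg₂d hg₁0 hg₁1 hB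
  simpa [hg, hh] using hmain

/-! ### Regular levels exist in every interval -/

/-- A horizontal plane of `ℝ³` has Hausdorff dimension at most `2` (it is the image of `ℝ × ℝ` under an
affine Lipschitz map). -/
theorem dimH_plane_le (a : ℝ) : dimH {z : (EuclideanSpace ℝ (Fin 3)) | z 2 = a} ≤ 2 := by
  set ι : ℝ × ℝ → (EuclideanSpace ℝ (Fin 3)) := fun p => p.1 • EuclideanSpace.single 0 1 + p.2 • EuclideanSpace.single 1 1 +
    a • EuclideanSpace.single 2 1 with hι
  have hιs : ContDiff ℝ 1 ι :=
    ((contDiff_fst.smul contDiff_const).add (contDiff_snd.smul contDiff_const)).add contDiff_const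
  have hsub : {z : (EuclideanSpace ℝ (Fin 3)) | z 2 = a} ⊆ range ι := by
    intro z hz
    refine ⟨(z 0, z 1), ?_⟩
    ext i
    fin_cases i
    · simp [hι]
    · simp [hι]
    · simpa [hι] using (hz : z 2 = a).symm
  calc dimH {z : (EuclideanSpace ℝ (Fin 3)) | z 2 = a} ≤ dimH (range ι) := dimH_mono hsub
    _ ≤ Module.finrank ℝ (ℝ × ℝ) := hιs.dimH_range_le
    _ = 2 := by norm_num

/-- **Regular levels of the stream function exist in every interval.** With `X, ψ` as in
`exists_cubic_increment`, for every centre `y₀`, radius `R` and `a < b` there is a level `c ∈ (a, b)` such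
that no point `z` of the horizontal plane through `y₀` with `dist z y₀ ≤ R` and `ψ z = c` is in-plane
critical (`X₀ z = X₁ z = 0`): the in-plane critical values in the ball are Lebesgue-null. -/
theorem exists_regular_level {X : (EuclideanSpace ℝ (Fin 3)) → (EuclideanSpace ℝ (Fin 3))} (hX : ContDiff ℝ 2 X) {ψ : (EuclideanSpace ℝ (Fin 3)) → ℝ}
    (hψ : Differentiable ℝ ψ)
    (hψ0 : ∀ y, fderiv ℝ ψ y (EuclideanSpace.single 0 1) = -(X y 1))
    (hψ1 : ∀ y, fderiv ℝ ψ y (EuclideanSpace.single 1 1) = X y 0)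
    (y₀ : (EuclideanSpace ℝ (Fin 3))) (R : ℝ) {a b : ℝ} (hab : a < b) :
    ∃ c ∈ Ioo a b, ∀ z : (EuclideanSpace ℝ (Fin 3)), z 2 = y₀ 2 → dist z y₀ ≤ R → ψ z = c → ¬ (X z 0 = 0 ∧ X z 1 = 0) := by
  obtain ⟨C, hC0, hC⟩ := exists_cubic_increment hX hψ hψ0 hψ1 (isCompact_closedBall y₀ R)
    (convex_closedBall y₀ R)
  set Z : Set (EuclideanSpace ℝ (Fin 3)) := {z | z 2 = y₀ 2 ∧ dist z y₀ ≤ R ∧ X z 0 = 0 ∧ X z 1 = 0} with hZ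
  -- `ψ` is Hölder with exponent `3` on `Z`
  have hHolder : HolderOnWith (Real.toNNReal C) 3 ψ Z := by
    intro z hz z' hz'
    have h := hC z' (mem_closedBall.2 hz'.2.1) z (mem_closedBall.2 hz.2.1) (by rw [hz.1, hz'.1])
      hz'.2.2.1 hz'.2.2.2 hz.2.2.1 hz.2.2.2
    change edist (ψ z) (ψ z') ≤ ENNReal.ofReal C * edist z z' ^ ((3 : ℝ≥0) : ℝ)
    rw [edist_dist, edist_dist, Real.dist_eq, dist_eq_norm,
      show ((3 : ℝ≥0) : ℝ) = ((3 : ℕ) : ℝ) by norm_num, ENNReal.rpow_natCast,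
      ← ENNReal.ofReal_pow (norm_nonneg _), ← ENNReal.ofReal_mul hC0]
    exact ENNReal.ofReal_le_ofReal h
  -- hence its image has `μH[1] = 0`, i.e. Lebesgue measure zero
  have hdim : dimH Z < (3 : ℝ≥0) := by
    have h1 : dimH Z ≤ 2 := (dimH_mono (fun z hz => hz.1)).trans (dimH_plane_le (y₀ 2))
    exact lt_of_le_of_lt h1 (by norm_num)
  have hZ3 : μH[((3 : ℝ≥0) : ℝ) * 1] Z = 0 := by
    rw [mul_one]
    exact hausdorffMeasure_of_dimH_lt hdim
  have himg : μH[1] (ψ '' Z) = 0 := by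
    have h := hHolder.hausdorffMeasure_image_le (by norm_num) (d := 1) zero_le_one
    rw [hZ3, mul_zero] at h
    exact nonpos_iff_eq_zero.1 h
  have hvol : volume (ψ '' Z) = 0 := by rw [← hausdorffMeasure_real]; exact himg
  -- an interval of positive length is not covered
  by_contra hcon
  push Not at hcon
  have hsub : Ioo a b ⊆ ψ '' Z := by
    intro c hc
    obtain ⟨z, hz2, hzd, hzc, hX0, hX1⟩ := hcon c hc
    exact ⟨z, ⟨hz2, hzd, hX0, hX1⟩, hzc⟩
  have h1 : volume (Ioo a b) ≤ volume (ψ '' Z) := measure_mono hsub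
  rw [hvol, Real.volume_Ioo, nonpos_iff_eq_zero, ENNReal.ofReal_eq_zero] at h1
  linarith

end Summit.NavierStokesRegularity.NavierStokesRegularity.Theorems.LoopPeriodRatchetNoPlanarExtremumSard

end
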